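import Mathlib
import Summits.ValiantsHypothesis.ValiantsHypothesis.Theses.ValuativeGCT
import Summits.ValiantsHypothesis.ValiantsHypothesis.Theorems.ValuativeGCTValuativeFlipRayFromBottom
import Literature.Computability.Complexity.OccurrenceObstructionsIPStability
import HarnessLib

/-!
# Sketch — crux idea `boundary-ray-collapse` for `ValuativeGCT.TailFlip` (stmt-ValiantsHypothesis-15687)

Round-2 ideator 4.  Statements only (they must elaborate; proofs are for the crux-plan / provers).
Letters: inner size `n`, base level `m` (a padded level, `n < m`; the card uses `m = 2n`), padding `j`,
level `m + j`, degree `δ`.  A shape `λ ⊢ m·δ` is a KADISH–LANDSBERG BOUNDARY shape for `(n, m)` if its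
first row is EXACTLY `δ(m-n)` (`lam.parts.sup = δ * (m - n)`); then `λ = (δ(m-n)) ∪ λ̄` with `λ̄ ⊢ nδ`
and its row-lift `λ♯(m+j) = (δ(m+j-n)) ∪ λ̄` is again a boundary shape, for `(n, m+j)`.

* `KLBoundaryTwistScalar` (FIRST LEMMA): on column-normalised points `A · X₀₀^{m-n} per_n` every monomial
  has top-letter exponent `≥ m - n`, and a highest-weight vector of boundary weight reads only the layer
  `e_top = m - n`; hence BIP's padding twist `(e_top + j)!/e_top!` acts on its evaluations as the SCALAR
  `((m-n+j)!/(m-n)!)^δ`.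
* `KLBoundaryPaddingInvariance` / `…Eq`: consequence with the tree's `RayFromBottom` identity
  `P(j) + dim K_j(λ) = a_λ(δ[m])`: the twisted kernels `K_j = K_0` coincide, so the padded-permanent
  multiplicity along a boundary ray is NON-DECREASING from the padded base `m` at EVERY padding, and
  CONSTANT when `λ₂ ≤ m`.
* `TopBoundaryFlip` (TRANSFER `C⁺`): one inequality per `(n, c)` — the rectangular Kronecker coefficient of the
  boundary shape at the window TOP against the padded-permanent multiplicity at level `2n`.
* `BoundaryCatchUp` (by-product, negative side): beyond Grenet the determinant's boundary ray dominates the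
  frozen level-`2n` permanent value.
-/

namespace Summit.ValiantsHypothesis.ValiantsHypothesis.Cruxes.TailFlip.BoundaryRayCollapse

open scoped BigOperators
open MvPolynomial
open Literature.NumberTheory.DiophantineGeometry
open Literature.Computability.AlgebraicComplexity
open Literature.Computability.Complexity

/-- Column-normalised matrices at a padded level `m > n` (the point family of the tree's ray theory,
`…RayFromBottom`): the `(0,0)`-th column of `A` is `e_top`, so `A · X₀₀^{m-n} per_n = X_top^{m-n} · per_n(A x)`. -/
def IsColNormalised (n m : ℕ) [NeZero m] (A : Matrix (MatIdx m) (MatIdx m) ℂ) : Prop :=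
  n < m → ∀ s, A s (toLex ((0 : Fin m), (0 : Fin m))) = if s = topMatIdx m then 1 else 0

/-- **FIRST LEMMA (KL-boundary twist invisibility).**  For `n < m`, `λ ⊢ m·δ` with at most `m²` parts and
first row EXACTLY `δ(m-n)`, every highest-weight vector `F` of weight `λ*` and every column-normalised `A`:
the `Δ_j`-twisted evaluation of `F` at `A · X₀₀^{m-n} per_n` is `((m-n+j).descFactorial j)^δ` times the
untwisted one — at boundary weight the Kadish–Landsberg/BIP padding twist is a scalar, for EVERY point. -/
def KLBoundaryTwistScalar : Prop :=
  ∀ (n m j δ : ℕ) [NeZero m], n < m → ∀ (lam : Nat.Partition (m * δ)), lam.parts.card ≤ m * m →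
    lam.parts.sup = δ * (m - n) →
    ∀ F ∈ highestWeightSpace (coordRep (MatIdx m) ℂ m) (partitionWeightLex m lam),
    ∀ A : Matrix (MatIdx m) (MatIdx m) ℂ, IsColNormalised n m A →
      aeval (fun e : DegIdx (MatIdx m) m =>
          (((e.1 (topMatIdx m) + j).descFactorial j : ℕ) : ℂ) *
            coeff e.1 (linSubst (MatIdx m) ℂ A (paddedPerFormLex ℂ n m))) F =
        ((((m - n + j).descFactorial j : ℕ) : ℂ) ^ δ) *
          aeval (fun e : DegIdx (MatIdx m) m => coeff e.1 (linSubst (MatIdx m) ℂ A (paddedPerFormLex ℂ n m))) F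

/-- **Boundary padding invariance, "≥" at EVERY padding from a PADDED base.**  For `n < m`, a boundary shape
`λ ⊢ m·δ` (`≤ m²` parts, first row `δ(m-n)`) and every `j`:
`mult_{λ*} ℂ[Δ_m(X₀₀^{m-n} per_n)] ≤ mult_{(λ♯(m+j))*} ℂ[Δ_{m+j}(X₀₀^{m+j-n} per_n)]`.
(Twisted kernel `K_j = K_0` by `KLBoundaryTwistScalar`; lifted highest-weight vectors of a complement of `K_0`
have nonsingular untwisted = twisted evaluation matrices; `…RayExceptions.le_orbitMultiplicity_rowLift_of_twistedDet_ne_zero`.) -/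
def KLBoundaryPaddingInvariance : Prop :=
  ∀ (n m j δ : ℕ) [NeZero m] [NeZero (m + j)], n < m → ∀ (lam : Nat.Partition (m * δ)),
    lam.parts.card ≤ m * m → lam.parts.sup = δ * (m - n) →
      orbitMultiplicity ℂ (paddedPerFormLex ℂ n m) m (partitionWeightLex m lam) ≤
        orbitMultiplicity ℂ (paddedPerFormLex ℂ n (m + j)) (m + j) (partitionWeightLex (m + j) (rowLift lam j))

/-- **Boundary padding invariance, EXACT form** (second row `λ₂ ≤ m`, so the Kadish–Landsberg lift is a bijection,
BIP Prop. 5.6(2) / tree `map_liftHWV_highestWeightSpace_eq`): the padded-permanent multiplicity is CONSTANT along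
the whole boundary ray.  With `m = 2n` the hypothesis `λ₂ ≤ 2n`... is NOT needed by the card (only `≤` is used). -/
def KLBoundaryPaddingInvarianceEq : Prop :=
  ∀ (n m j δ : ℕ) [NeZero m] [NeZero (m + j)], n < m → ∀ (lam : Nat.Partition (m * δ)),
    lam.parts.card ≤ m * m → lam.parts.sup = δ * (m - n) → lam.sortedParts.getD 1 0 ≤ m →
      orbitMultiplicity ℂ (paddedPerFormLex ℂ n (m + j)) (m + j) (partitionWeightLex (m + j) (rowLift lam j)) =
        orbitMultiplicity ℂ (paddedPerFormLex ℂ n m) m (partitionWeightLex m lam)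

/-- **TRANSFER `C⁺` (window-top boundary flip, Kronecker form).**  For every window exponent `c` and all large
`n` there is ONE degree `δ` and ONE boundary shape `λ ⊢ 2n·δ` (first row `δn`, at most `n²+1` parts) such that the
rectangular Kronecker coefficient of its row-lift to the window TOP `M = 2^((log₂ n + c)^c)` is smaller than the
padded-permanent multiplicity at level `2n`.  By Manivel monotonicity (`kroneckerCoeff_le_kroneckerCoeff_rowLift`),
the census bound `dim T_⊥ ≤ g` (`stub_truncT0_le_kronecker`), `KLBoundaryPaddingInvariance` and inner
monotonicity, `C⁺ → ValuativeFlip (→ TailFlip)`: the whole window flips at boundary shapes with the no-cut centre. -/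
def TopBoundaryFlip : Prop :=
  ∀ c : ℕ, ∃ n₀ : ℕ, ∀ n ≥ n₀, ∀ [NeZero (2 * n)], 2 * n ≤ 2 ^ ((Nat.log 2 n + c) ^ c) ∧
    ∃ (δ : ℕ) (lam : Nat.Partition ((2 * n) * δ)),
      lam.parts.card ≤ n * n + 1 ∧ lam.parts.sup = δ * n ∧
      kroneckerCoeff ℂ (rowLift lam (2 ^ ((Nat.log 2 n + c) ^ c) - 2 * n))
          (Nat.Partition.rectangle (2 * n + (2 ^ ((Nat.log 2 n + c) ^ c) - 2 * n)) δ)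
          (Nat.Partition.rectangle (2 * n + (2 ^ ((Nat.log 2 n + c) ^ c) - 2 * n)) δ) <
        orbitMultiplicity ℂ (paddedPerFormLex ℂ n (2 * n)) (2 * n) (partitionWeightLex (2 * n) lam)

/-- **By-product (negative side): Grenet ⇒ the determinant's boundary ray dominates the frozen permanent value.**
For `2^n ≤ 2n + j + 1` the padded permanent lies in `End · det_{2n+j}` (Grenet), so
`mult_{λ*} ℂ[Δ_{2n}(X₀₀^n per_n)] ≤ K_{2n+j}((λ♯(2n+j))*)` for every boundary shape `λ` of `(n, 2n)`;
with `stub_truncT0_le_kronecker` also `≤ g(λ♯, (2n+j)×δ, (2n+j)×δ)`, and letting `j → ∞`,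
`≤` Manivel's stable value `a_{λ̄}(δ)`. -/
def BoundaryCatchUp : Prop :=
  ∀ (n j δ : ℕ) [NeZero (2 * n)] [NeZero (2 * n + j)] (lam : Nat.Partition ((2 * n) * δ)),
    lam.parts.card ≤ (2 * n) * (2 * n) → lam.parts.sup = δ * n → 2 ^ n ≤ 2 * n + j + 1 →
      orbitMultiplicity ℂ (paddedPerFormLex ℂ n (2 * n)) (2 * n) (partitionWeightLex (2 * n) lam) ≤
        orbitMultiplicity ℂ (detFormLex ℂ (2 * n + j)) (2 * n + j) (partitionWeightLex (2 * n + j) (rowLift lam j))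

/-! ## Sanity: the statements typecheck against the crux and the landed ray theory -/

example : Prop := KLBoundaryTwistScalar ∧ KLBoundaryPaddingInvariance ∧ TopBoundaryFlip ∧ BoundaryCatchUp

#check @Summit.ValiantsHypothesis.ValiantsHypothesis.Theorems.ValuativeFlip.orbitMultiplicity_rowLift_add_finrank_twistKer
#check @kroneckerCoeff_le_kroneckerCoeff_rowLift
#check @Summit.ValiantsHypothesis.ValiantsHypothesis.Theses.ValuativeGCT.TailFlip

end Summit.ValiantsHypothesis.ValiantsHypothesis.Cruxes.TailFlip.BoundaryRayCollapse
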